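import Summits.BirchSwinnertonDyer.BirchSwinnertonDyer.Theses.ShadowIsolation
import Literature.NumberTheory.EllipticCurves.NewformAbelianVariety
import Literature.NumberTheory.EllipticCurves.NewformsHeckeProofs
import Literature.NumberTheory.EllipticCurves.CuspFormLFunctionProofs

/-!
# Skeleton for crux `PhantomShadow` (route ShadowIsolation, item stmt-BirchSwinnertonDyer-15787), line `birth`
  (payload slug `registered`), lead generation c3 — reshape r3 (2026-08-17): IDEAL FORM of the shadow point +
  congruence glue

Line: a Ш-class of exact order `p ^ n` is made VISIBLE, by sign-kept level raising mod `p ^ n`,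
in `(E × A_g)/Δ` for an even-sign newform `g` of squarefree coprime level `N_W · M`, depth-`n`
congruent to `W`; with `E[p]` irreducible the non-Eisenstein lemma turns visibility into a
rational point of infinite order on Shimura's abelian variety `A_g`; Kato's theorem
(Astérisque 295, Cor. 14.3: `L(g,1) ≠ 0 ⇒ A_g(ℚ)` finite) and Hecke's entire continuation of
`L(g,s)` turn that point into the central zero `Λ(g,1) = 0` the crux asks for.

History. r0 (planner, sha 626b9600ab32): stubs V∘C1 + (Kato∘Hecke). r1 (lead c1, 8e41e398a243): the
Kato∘Hecke stub split into the named fact `stub_katoFinite` (Kato Cor. 14.3 over the interface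
`NewformAbelianVariety`, filed and ACCEPTED as the Literature fact
`Literature.NumberTheory.EllipticCurves.kato_finite_mordellWeil_of_newformAbelianVariety`, p145371) and the glue
`stub_centralVanishing_of_finite` (Hecke 1936, PROVED; landed p145360). r2 (lead c2, f5397a1cc609): glue
inlined, sorries 2.

Reshape r3 (lead c3, this file). The conjectural stub is restated in the LITERATURE'S form and the
typed-congruence bookkeeping is split off as a provable stub:

* `stub_visibleShadowPointIdeal` (OPEN — the conjecture V∘C1, crux-sized): same hypotheses and
  conclusion as the r0–r2 stub `stub_visibleShadowPoint`, except that the depth-`n` congruence is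
  expressed, as in every source (Ribet 1990; Bertolini–Darmon 2005, `𝕋/I ≅ ℤ/pⁿ`; Cremona–Mazur 2000 §3
  and Agashe–Stein 2002 Thm. 3.1, `A_g[𝔪] ≅ E[p]`), by an IDEAL `I` of the coefficient order
  `ℤ[{aₙ(g)}] = coeffOrder g` with `ℤ ∩ I = pⁿℤ` and `a_ℓ(g) ≡ a_ℓ(W) (mod I)` for the primes
  `ℓ ∤ N_W·M` — exactly the ideal through which the visibility congruence `Δ ≅ E[pⁿ] ≅ A_g[I]` is
  expressed over the interface (`NewformAbelianVariety.idealTorsion I = A_g[I]`), so that the future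
  layer-2 item DeepVisibility can discharge this stub without re-plumbing;
* `stub_congruenceHom_of_ideal` (PROVED, pure algebra, proof below in §2; LANDED p149942 as
  `Summit.BirchSwinnertonDyer.BirchSwinnertonDyer.Theorems.stub_congruenceHom_of_ideal`, file
  `Theorems/ShadowIsolationPhantomShadowStubCongruenceHomOfIdeal.lean`): for a newform `g` on
  `Γ₀(N)`, an ideal `I ⊆ ℤ[{aₙ(g)}]` with `ℤ ∩ I ⊆ mℤ` and integers `b_ℓ` with `a_ℓ(g) − b_ℓ ∈ I`
  (`ℓ ∤ N` prime) give a subring `R ⊆ ℂ` containing the Hecke eigenvalues `heckeEigenvalue g ℓ`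
  (`= a_ℓ(g)`, Atkin–Lehner Thm. 3, PROVED in tree: `heckeEigenvalue_eq_coeff_of_isNormalized`) and a
  ring homomorphism `φ : R →+* ZMod m` with `φ(a_ℓ(g)) = b_ℓ` — the crux's typed congruence. Proof:
  `R` = (image in `ℂ` of) the preimage `B ⊆ ℤ[{aₙ(g)}]` of the subring `im(ℤ → ℤ[{aₙ(g)}]/I)`;
  `φ = (ℤ/ker ≅ im) ; (ℤ/ker → ℤ/m) ; (ℤ/m ≅ ZMod m)` after `B → im`; the value at `a_ℓ(g)` is the
  value at the integer `b_ℓ`, which any ring hom sends to `b_ℓ mod m`.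
* `stub_katoFinite` (named fact, unchanged) and `stub_centralVanishing_of_finite` (landed glue,
  unchanged, proof inline).

Composition: `PhantomShadow_of : Sig.stub_visibleShadowPointIdeal → Sig.stub_congruenceHom_of_ideal →
Sig.stub_katoFinite → Sig.stub_centralVanishing_of_finite → PhantomShadow` (kernel-checked, no sorry,
concludes the route decl BY NAME); registered target `PhantomShadow_skeleton`. Open after r3:
`stub_visibleShadowPointIdeal` (conjecture V∘C1 — OPEN at every `n ≥ 1`: no sign-kept visibility theorem
for a GIVEN Ш-class even at `n = 1`; the Ш-free SUPPLY of strongly depth-`n` congruent newforms at squarefree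
coprime level is in print for `p ≥ 7` and big image — Camporino–Pacetti 2018, doi:10.4171/rmi/1037, Thm A/B —
up to sign control at their auxiliary primes; the open content is SELECTING one with points / an exact central
zero) and `stub_katoFinite` (accepted named fact, Euler-system debt).
Sorries: 2.

Layout (the `#h21_check_skeleton` invariant): §1 the stub STATEMENTS as plain `Prop`s
`Sig.stub_<name>`; §2 the stubs `theorem stub_<name> : <the same statement, inlined>` — the open ones
`:= by sorry` (the ONLY sorries of the file), the provable ones proved; §3 the kernel-checked
composition and the registered target `PhantomShadow_skeleton : PhantomShadow`.

Disproof used: none relevant — no `Disproof.lean` exists for this crux (2026-08-17T07:50Z, `ledger crux ls`: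
Lines/birth.lean, Lines/birth.md, PICKED.md only). Negatives index (BirchSwinnertonDyer): no refuted
statement concerns visibility, level raising or central values of congruent forms.
-/

set_option linter.dupNamespace false

namespace Summit.BirchSwinnertonDyer.BirchSwinnertonDyer.Cruxes.PhantomShadow.Birth

open Literature
open Literature.NumberTheory.EllipticCurves.ModularForms

/-! ## §1 Stub statements (plain `Prop`s over tree vocabulary; `Sig.stub_<name>` ≡ the signature of `stub_<name>`) -/

/-- Statement of stub V∘C1 in IDEAL FORM (sign-kept deep visibility ⇒ a shadow POINT). For `W/ℚ`
globally minimal elliptic, `p ≥ 5` good ordinary with `E[p]` irreducible, `n ≥ 1`: if `Ш(W)` has an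
element of exact order `p ^ n`, then there are `M` squarefree with `(M, p·N_W) = 1`, a newform
`g ∈ S₂(Γ₀(N_W·M))`, not the newform of `W` (q-expansion mismatch), with Fricke eigenvalue `−1`
(even sign: `w g = −g` for the weight-2 double-coset operator of `w = S·diag(N_W·M, 1)`), an ideal
`I` of the coefficient order `ℤ[{aₙ(g)}]` with `ℤ ∩ I = pⁿℤ` and `a_ℓ(g) ≡ a_ℓ(W) (mod I)` for every
prime `ℓ ∤ N_W·M` (a depth-`n` congruence in the sense of Ribet / Bertolini–Darmon / Cremona–Mazur),
and Shimura data `D : NewformAbelianVariety g` whose Mordell–Weil group `A_g(ℚ)` is INFINITE.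
Intended proof: two `n`-admissible primes of compensating signs (Bertolini–Darmon 2005 §2), level
raising mod `p ^ n` to a genuine newform (Ribet 1990, Diamond–Taylor 1994 at `n = 1`; Camporino–Pacetti
2018 Thm A/B at `n ≥ 2` for `p ≥ 7` and big image, sign control at the auxiliary Steinberg primes not in
print), visibility of `σ` in `(E × A_g)/Δ`, `Δ ≅ E[pⁿ] ≅ A_g[I]`
(Cremona–Mazur 2000 §3, Agashe–Stein 2002 Thm 3.1, Jetchev–Stein 2007 Thm 5.1.3 at depth 1 /
Conj 7.1.1), and the non-Eisenstein lemma (rank `A_g(ℚ) = 0` and `E[p]` irreducible leave no `p`-power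
visible class). OPEN at every depth `n ≥ 1`. -/
def Sig.stub_visibleShadowPointIdeal : Prop :=
  ∀ (W : WeierstrassCurve ℚ) [W.IsElliptic] [W.IsGloballyMinimal] (p : ℕ) [Fact p.Prime], 5 ≤ p → W.HasGoodReductionAtPrime p → ¬ (p : ℤ) ∣ W.frobeniusTrace p → W.HasIrreducibleModPGaloisRep p → ∀ n : ℕ, 1 ≤ n → (∃ σ : W.sha, addOrderOf σ = p ^ n) → ∃ (M : ℕ) (_ : NeZero (W.conductorNorm ℤ * M)) (g : CuspForm (CongruenceSubgroup.Gamma0 (W.conductorNorm ℤ * M)) 2) (I : Ideal (Literature.NumberTheory.EllipticCurves.ModularForms.coeffOrder g)), Squarefree M ∧ Nat.Coprime M (p * W.conductorNorm ℤ) ∧ Literature.NumberTheory.EllipticCurves.ModularForms.IsNewform0 g ∧ (∃ m : ℕ, (UpperHalfPlane.qExpansion 1 ⇑g).coeff m ≠ ((W.LFunction m : ℤ) : ℂ)) ∧ Literature.NumberTheory.EllipticCurves.ModularForms.cuspHeckeOperatorₗ (CongruenceSubgroup.Gamma0 (W.conductorNorm ℤ * M)) 2 (Literature.NumberTheory.EllipticCurves.ModularForms.slToGLPos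 ModularGroup.S * Literature.NumberTheory.EllipticCurves.ModularForms.diagGL ((W.conductorNorm ℤ * M : ℕ) : ℚ) 1 (Nat.cast_pos.mpr (NeZero.pos (W.conductorNorm ℤ * M))) one_pos) g = -g ∧ Ideal.comap (algebraMap ℤ (Literature.NumberTheory.EllipticCurves.ModularForms.coeffOrder g)) I = Ideal.span {((p ^ n : ℕ) : ℤ)} ∧ (∀ ℓ : ℕ, ℓ.Prime → ¬ ℓ ∣ W.conductorNorm ℤ * M → Literature.NumberTheory.EllipticCurves.ModularForms.coeffOrder.coeff g ℓ - ((W.frobeniusTrace ℓ : ℤ) : Literature.NumberTheory.EllipticCurves.ModularForms.coeffOrder g) ∈ I) ∧ ∃ D : Literature.NumberTheory.EllipticCurves.ModularForms.NewformAbelianVariety g, Infinite (D.A.Points ℚ)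

/-- Statement of the congruence glue (PROVABLE NOW, pure algebra + Atkin–Lehner Thm. 3): for a newform
`g ∈ S₂(Γ₀(N))`, a modulus `m`, integers `b_ℓ` and an ideal `I ⊆ ℤ[{aₙ(g)}]` with `ℤ ∩ I ⊆ mℤ` and
`a_ℓ(g) − b_ℓ ∈ I` for the primes `ℓ ∤ N`, there are a subring `R ⊆ ℂ` containing every Hecke
eigenvalue `heckeEigenvalue g ℓ` (`ℓ ∤ N` prime) and a ring homomorphism `φ : R →+* ZMod m` with
`φ(heckeEigenvalue g ℓ) = b_ℓ (mod m)` — the typed congruence of the crux. -/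
def Sig.stub_congruenceHom_of_ideal : Prop :=
  ∀ (N : ℕ) [NeZero N] (g : CuspForm (CongruenceSubgroup.Gamma0 N) 2), Literature.NumberTheory.EllipticCurves.ModularForms.IsNewform0 g → ∀ (m : ℕ) (b : ℕ → ℤ) (I : Ideal (Literature.NumberTheory.EllipticCurves.ModularForms.coeffOrder g)), Ideal.comap (algebraMap ℤ (Literature.NumberTheory.EllipticCurves.ModularForms.coeffOrder g)) I ≤ Ideal.span {(m : ℤ)} → (∀ ℓ : ℕ, ℓ.Prime → ¬ ℓ ∣ N → Literature.NumberTheory.EllipticCurves.ModularForms.coeffOrder.coeff g ℓ - (b ℓ : Literature.NumberTheory.EllipticCurves.ModularForms.coeffOrder g) ∈ I) → ∃ (R : Subring ℂ) (φ : R →+* ZMod m) (hR : ∀ ℓ : ℕ, ℓ.Prime → ¬ ℓ ∣ N → Literature.NumberTheory.EllipticCurves.ModularForms.heckeEigenvalue g ℓ ∈ R), ∀ (ℓ : ℕ) (hℓ : ℓ.Prime) (hℓN : ¬ ℓ ∣ N), φ ⟨Literature.NumberTheory.EllipticCurves.ModularForms.heckeEigenvalue g ℓ, hR ℓ hℓ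 hℓN⟩ = (b ℓ : ZMod m)

/-- Statement of stub K (Kato's analytic-rank-zero theorem for modular abelian varieties, VERBATIM the
tree's named fact `Literature.NumberTheory.EllipticCurves.kato_finite_mordellWeil_of_newformAbelianVariety`
(file `KatoNewformAbelianVarietyFiniteness.lean`, p145371) over the interface `NewformAbelianVariety`, unfolded). For ANY level `N ≥ 1`,
any newform `g ∈ S₂(Γ₀(N))`, any Shimura data `D : NewformAbelianVariety g` and any entire function `Λ`
agreeing with the `L`-series `Σ aₙ(g) n^(-s)` on the half-plane `re s > 2` of absolute convergence (such a
`Λ` exists by Hecke 1936 and is unique by the identity theorem, so `Λ 1` IS `L(g,1)`): if `Λ 1 ≠ 0` then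
the Mordell–Weil group `A_g(ℚ) = D.A.Points ℚ` is finite. Printed sources: Kato 2004 (Astérisque 295)
Cor. 14.3 — `L(A,1) ≠ 0 ⇒ A(ℚ)` finite for quotients `A` of `J₁(N)`, in particular `A_g`; earlier
Kolyvagin–Logachev 1989; `D.A` is `ℚ`-isogenous to Shimura's `A_g` (Faltings 1983, from the Frobenius
characteristic polynomials recorded in the interface), and finiteness of the Mordell–Weil group is an
isogeny invariant. A theorem in print, NOT provable in tree (Euler system of Beilinson–Kato elements). -/
def Sig.stub_katoFinite : Prop :=
  ∀ (N : ℕ) [NeZero N] (g : CuspForm (CongruenceSubgroup.Gamma0 N) 2), Literature.NumberTheory.EllipticCurves.ModularForms.IsNewform0 g → ∀ (D : Literature.NumberTheory.EllipticCurves.ModularForms.NewformAbelianVariety g) (Λ : ℂ → ℂ), Differentiable ℂ Λ → (∀ s : ℂ, 2 < s.re → Λ s = LSeries (fun m ↦ (UpperHalfPlane.qExpansion 1 ⇑g).coeff m) s) → Λ 1 ≠ 0 → Finite (D.A.Points ℚ)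

/-- Statement of the analytic glue stub (PROVED, landed p145360): for ANY level `N ≥ 1`, any `g ∈ S₂(Γ₀(N))` and any
`D : NewformAbelianVariety g`, IF "some entire continuation of `Σ aₙ(g) n^(-s)` is non-zero at `s = 1`
forces `A_g(ℚ)` finite" (the instance of `Sig.stub_katoFinite` at `(N, g, D)`), THEN `A_g(ℚ)` infinite
forces an entire continuation `Λ` of the `L`-series (`re s > 2`) with `Λ 1 = 0` (Hecke's entire
continuation for cusp forms on `Γ₀(N)` is PROVED in tree:
`Literature.NumberTheory.EllipticCurves.ModularForms.exists_differentiable_eq_cuspFormLSeries_holds`). -/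
def Sig.stub_centralVanishing_of_finite : Prop :=
  ∀ (N : ℕ) [NeZero N] (g : CuspForm (CongruenceSubgroup.Gamma0 N) 2) (D : Literature.NumberTheory.EllipticCurves.ModularForms.NewformAbelianVariety g), (∀ Λ : ℂ → ℂ, Differentiable ℂ Λ → (∀ s : ℂ, 2 < s.re → Λ s = LSeries (fun m ↦ (UpperHalfPlane.qExpansion 1 ⇑g).coeff m) s) → Λ 1 ≠ 0 → Finite (D.A.Points ℚ)) → Infinite (D.A.Points ℚ) → ∃ Λ : ℂ → ℂ, Differentiable ℂ Λ ∧ (∀ s : ℂ, 2 < s.re → Λ s = LSeries (fun m ↦ (UpperHalfPlane.qExpansion 1 ⇑g).coeff m) s) ∧ Λ 1 = 0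

/-! ## §2 Stubs (signatures inlined = self-contained over tree declarations): two OPEN (the ONLY sorries of the
   file: `stub_visibleShadowPointIdeal`, `stub_katoFinite`) and two PROVED (`stub_congruenceHom_of_ideal`,
   `stub_centralVanishing_of_finite`) -/

/-- Stub V∘C1, ideal form (OPEN, hardest, crux-sized): sign-kept deep visibility ⇒ a rational point of infinite
order on a congruent `A_g`, the congruence carried by an ideal `I ⊆ ℤ[{aₙ(g)}]` with `ℤ ∩ I = pⁿℤ`
(statement `Sig.stub_visibleShadowPointIdeal`, inlined). -/
theorem stub_visibleShadowPointIdeal : ∀ (W : WeierstrassCurve ℚ) [W.IsElliptic] [W.IsGloballyMinimal] (p : ℕ) [Fact p.Prime], 5 ≤ p → W.HasGoodReductionAtPrime p → ¬ (p : ℤ) ∣ W.frobeniusTrace p → W.HasIrreducibleModPGaloisRep p → ∀ n : ℕ, 1 ≤ n → (∃ σ : W.sha, addOrderOf σ = p ^ n) → ∃ (M : ℕ) (_ : NeZero (W.conductorNorm ℤ * M)) (g : CuspForm (CongruenceSubgroup.Gamma0 (W.conductorNorm ℤ * M)) 2) (I : Ideal (Literature.NumberTheory.EllipticCurves.ModularForms.coeffOrder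 g)), Squarefree M ∧ Nat.Coprime M (p * W.conductorNorm ℤ) ∧ Literature.NumberTheory.EllipticCurves.ModularForms.IsNewform0 g ∧ (∃ m : ℕ, (UpperHalfPlane.qExpansion 1 ⇑g).coeff m ≠ ((W.LFunction m : ℤ) : ℂ)) ∧ Literature.NumberTheory.EllipticCurves.ModularForms.cuspHeckeOperatorₗ (CongruenceSubgroup.Gamma0 (W.conductorNorm ℤ * M)) 2 (Literature.NumberTheory.EllipticCurves.ModularForms.slToGLPos ModularGroup.S * Literature.NumberTheory.EllipticCurves.ModularForms.diagGL ((W.conductorNorm ℤ * M : ℕ) : ℚ) 1 (Nat.cast_pos.mpr (NeZero.pos (W.conductorNorm ℤ * M))) one_pos) g = -g ∧ Ideal.comap (algebraMap ℤ (Literature.NumberTheory.EllipticCurves.ModularForms.coeffOrder g)) I = Ideal.span {((p ^ n : ℕ) : ℤ)} ∧ (∀ ℓ : ℕ, ℓ.Prime → ¬ ℓ ∣ W.conductorNorm ℤ * M → Literature.NumberTheory.EllipticCurves.ModularForms.coeffOrder.coeff g ℓ - ((W.frobeniusTrace ℓ : ℤ) : Literature.NumberTheory.EllipticCurves.ModularForms.coeffOrder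 g) ∈ I) ∧ ∃ D : Literature.NumberTheory.EllipticCurves.ModularForms.NewformAbelianVariety g, Infinite (D.A.Points ℚ) := by
  sorry

/-- Congruence glue (PROVED; identical statement and proof landed as p149942,
`Summit.BirchSwinnertonDyer.BirchSwinnertonDyer.Theorems.stub_congruenceHom_of_ideal`): an ideal `I ⊆ ℤ[{aₙ(g)}]` with `ℤ ∩ I ⊆ mℤ` and `a_ℓ(g) ≡ b_ℓ (mod I)` at the
primes `ℓ ∤ N` yields the crux's typed congruence — a subring `R ⊆ ℂ` containing the Hecke eigenvalues of
the newform `g` and `φ : R →+* ZMod m` with `φ(a_ℓ(g)) = b_ℓ` (statement `Sig.stub_congruenceHom_of_ideal`,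
inlined). `R` is the image in `ℂ` of the preimage `B ⊆ ℤ[{aₙ(g)}]` of `im(ℤ → ℤ[{aₙ(g)}]/I)`, and `φ` is
`B → im(ℤ) ≅ ℤ/ker → ℤ/mℤ ≅ ZMod m`; `heckeEigenvalue g ℓ = a_ℓ(g)` for the normalised eigenform `g` is the
tree's `heckeEigenvalue_eq_coeff_of_isNormalized` (Atkin–Lehner 1970, Thm. 3). [folklore] -/
theorem stub_congruenceHom_of_ideal : ∀ (N : ℕ) [NeZero N] (g : CuspForm (CongruenceSubgroup.Gamma0 N) 2), Literature.NumberTheory.EllipticCurves.ModularForms.IsNewform0 g → ∀ (m : ℕ) (b : ℕ → ℤ) (I : Ideal (Literature.NumberTheory.EllipticCurves.ModularForms.coeffOrder g)), Ideal.comap (algebraMap ℤ (Literature.NumberTheory.EllipticCurves.ModularForms.coeffOrder g)) I ≤ Ideal.span {(m : ℤ)} → (∀ ℓ : ℕ, ℓ.Prime → ¬ ℓ ∣ N → Literature.NumberTheory.EllipticCurves.ModularForms.coeffOrder.coeff g ℓ - (b ℓ : Literature.NumberTheory.EllipticCurves.ModularForms.coeffOrder g) ∈ I) → ∃ (R : Subring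 ℂ) (φ : R →+* ZMod m) (hR : ∀ ℓ : ℕ, ℓ.Prime → ¬ ℓ ∣ N → Literature.NumberTheory.EllipticCurves.ModularForms.heckeEigenvalue g ℓ ∈ R), ∀ (ℓ : ℕ) (hℓ : ℓ.Prime) (hℓN : ¬ ℓ ∣ N), φ ⟨Literature.NumberTheory.EllipticCurves.ModularForms.heckeEigenvalue g ℓ, hR ℓ hℓ hℓN⟩ = (b ℓ : ZMod m) := by
  intro N _ g hg m b I hI hcongr
  classical
  -- the embedding of the coefficient order `A = ℤ[{aₙ(g)}]` into `ℂ`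
  let fA : Literature.NumberTheory.EllipticCurves.ModularForms.coeffOrder g →+* ℂ :=
    SubringClass.subtype (Literature.NumberTheory.EllipticCurves.ModularForms.coeffOrder g)
  have hfA : Function.Injective fA := Subtype.val_injective
  -- `ψ : ℤ → A/I`, with kernel `ℤ ∩ I ⊆ mℤ`
  let ψ : ℤ →+* (Literature.NumberTheory.EllipticCurves.ModularForms.coeffOrder g ⧸ I) :=
    (Ideal.Quotient.mk I).comp (algebraMap ℤ (Literature.NumberTheory.EllipticCurves.ModularForms.coeffOrder g))
  have hker : RingHom.ker ψ ≤ Ideal.span {(m : ℤ)} := by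
    intro z hz
    apply hI
    rw [Ideal.mem_comap]
    rw [RingHom.mem_ker] at hz
    exact Ideal.Quotient.eq_zero_iff_mem.mp hz
  -- `B` = preimage in `A` of the subring `im ψ ⊆ A/I`; `ρ : B → im ψ`; `χ : im ψ → ZMod m`
  let B : Subring (Literature.NumberTheory.EllipticCurves.ModularForms.coeffOrder g) :=
    ψ.range.comap (Ideal.Quotient.mk I)
  let ρ : B →+* ψ.range := (Ideal.Quotient.mk I).restrict B ψ.range (fun x hx ↦ Subring.mem_comap.mp hx)
  let χ : ψ.range →+* ZMod m :=
    ((Int.quotientSpanNatEquivZMod m).toRingHom.comp (Ideal.Quotient.factor hker)).comp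
      (RingHom.quotientKerEquivRange ψ).symm.toRingHom
  let φB : B →+* ZMod m := χ.comp ρ
  -- the generators `a_ℓ(g)` lie in `B`, with `ρ(a_ℓ(g)) = ρ(b_ℓ)`
  have hmemB : ∀ ℓ : ℕ, ℓ.Prime → ¬ ℓ ∣ N →
      Literature.NumberTheory.EllipticCurves.ModularForms.coeffOrder.coeff g ℓ ∈ B := by
    intro ℓ hℓ hℓN
    change Ideal.Quotient.mk I (Literature.NumberTheory.EllipticCurves.ModularForms.coeffOrder.coeff g ℓ) ∈ ψ.range
    refine RingHom.mem_range.mpr ⟨b ℓ, ?_⟩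
    change Ideal.Quotient.mk I (algebraMap ℤ _ (b ℓ)) =
      Ideal.Quotient.mk I (Literature.NumberTheory.EllipticCurves.ModularForms.coeffOrder.coeff g ℓ)
    rw [eq_intCast]
    exact (Ideal.Quotient.eq.mpr (hcongr ℓ hℓ hℓN)).symm
  have hcoe : ∀ ℓ : ℕ, ℓ.Prime →
      fA (Literature.NumberTheory.EllipticCurves.ModularForms.coeffOrder.coeff g ℓ) =
        Literature.NumberTheory.EllipticCurves.ModularForms.heckeEigenvalue g ℓ := by
    intro ℓ hℓ
    change ((Literature.NumberTheory.EllipticCurves.ModularForms.coeffOrder.coeff g ℓ :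
        Literature.NumberTheory.EllipticCurves.ModularForms.coeffOrder g) : ℂ) = _
    rw [Literature.NumberTheory.EllipticCurves.ModularForms.coeffOrder.coe_coeff,
      heckeEigenvalue_eq_coeff_of_isNormalized hg.2.2 hℓ (hg.2.1 ℓ hℓ)]
  -- push `B` into `ℂ`
  let e : B ≃+* B.map fA := B.equivMapOfInjective fA hfA
  have hR : ∀ ℓ : ℕ, ℓ.Prime → ¬ ℓ ∣ N →
      Literature.NumberTheory.EllipticCurves.ModularForms.heckeEigenvalue g ℓ ∈ B.map fA := by
    intro ℓ hℓ hℓN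
    exact Subring.mem_map.mpr ⟨_, hmemB ℓ hℓ hℓN, hcoe ℓ hℓ⟩
  refine ⟨B.map fA, φB.comp e.symm.toRingHom, hR, ?_⟩
  intro ℓ hℓ hℓN
  have hex : e ⟨Literature.NumberTheory.EllipticCurves.ModularForms.coeffOrder.coeff g ℓ, hmemB ℓ hℓ hℓN⟩ =
      ⟨Literature.NumberTheory.EllipticCurves.ModularForms.heckeEigenvalue g ℓ, hR ℓ hℓ hℓN⟩ :=
    Subtype.ext (by rw [Subring.coe_equivMapOfInjective_apply]; exact hcoe ℓ hℓ)
  change φB (e.symm ⟨Literature.NumberTheory.EllipticCurves.ModularForms.heckeEigenvalue g ℓ, hR ℓ hℓ hℓN⟩) = _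
  rw [← hex, e.symm_apply_apply]
  have hρ : ρ ⟨Literature.NumberTheory.EllipticCurves.ModularForms.coeffOrder.coeff g ℓ, hmemB ℓ hℓ hℓN⟩ =
      ρ (b ℓ : B) := by
    apply Subtype.ext
    rw [RingHom.coe_restrict_apply, RingHom.coe_restrict_apply, Subring.coe_intCast, Ideal.Quotient.eq]
    exact hcongr ℓ hℓ hℓN
  calc φB ⟨_, hmemB ℓ hℓ hℓN⟩ = χ (ρ ⟨_, hmemB ℓ hℓ hℓN⟩) := rfl
    _ = χ (ρ (b ℓ : B)) := by rw [hρ]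
    _ = φB (b ℓ : B) := rfl
    _ = (b ℓ : ZMod m) := map_intCast φB (b ℓ)

/-- Stub K (named fact, theorem in print: Kato 2004 Cor. 14.3 (2) / Kolyvagin–Logachev): `L(g,1) ≠ 0 ⇒ A_g(ℚ)`
finite, over the interface (statement `Sig.stub_katoFinite`, inlined) — VERBATIM the tree's named fact
`Literature.NumberTheory.EllipticCurves.kato_finite_mordellWeil_of_newformAbelianVariety` (landed p145371), unfolded.
Discharged by that fact's `_holds` once proved (Euler-system debt); until then the skeleton is closed MODULO it. -/
theorem stub_katoFinite : ∀ (N : ℕ) [NeZero N] (g : CuspForm (CongruenceSubgroup.Gamma0 N) 2), Literature.NumberTheory.EllipticCurves.ModularForms.IsNewform0 g → ∀ (D : Literature.NumberTheory.EllipticCurves.ModularForms.NewformAbelianVariety g) (Λ : ℂ → ℂ), Differentiable ℂ Λ → (∀ s : ℂ, 2 < s.re → Λ s = LSeries (fun m ↦ (UpperHalfPlane.qExpansion 1 ⇑g).coeff m) s) → Λ 1 ≠ 0 → Finite (D.A.Points ℚ) := by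
  sorry

/-- Analytic glue — CLOSED (identical statement and proof landed as p145360,
`Summit.BirchSwinnertonDyer.BirchSwinnertonDyer.Theorems.stub_centralVanishing_of_finite`): Kato-at-`(N,g,D)` +
`A_g(ℚ)` infinite ⇒ Hecke's entire continuation of `Σ aₙ(g) n^(-s)` (proved in tree:
`exists_differentiable_eq_cuspFormLSeries_holds`, Hecke 1936 / Diamond–Shurman Thm. 5.10.2) vanishes at `s = 1`
(statement `Sig.stub_centralVanishing_of_finite`, inlined). -/
theorem stub_centralVanishing_of_finite : ∀ (N : ℕ) [NeZero N] (g : CuspForm (CongruenceSubgroup.Gamma0 N) 2) (D : Literature.NumberTheory.EllipticCurves.ModularForms.NewformAbelianVariety g), (∀ Λ : ℂ → ℂ, Differentiable ℂ Λ → (∀ s : ℂ, 2 < s.re → Λ s = LSeries (fun m ↦ (UpperHalfPlane.qExpansion 1 ⇑g).coeff m) s) → Λ 1 ≠ 0 → Finite (D.A.Points ℚ)) → Infinite (D.A.Points ℚ) → ∃ Λ : ℂ → ℂ, Differentiable ℂ Λ ∧ (∀ s : ℂ, 2 < s.re → Λ s = LSeries (fun m ↦ (UpperHalfPlane.qExpansion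 1 ⇑g).coeff m) s) ∧ Λ 1 = 0 := by
  intro N _ g D hK hinf
  obtain ⟨L, hL, hLeq⟩ := exists_differentiable_eq_cuspFormLSeries_holds (k := 2) g
  have hagree : ∀ s : ℂ, 2 < s.re → L s = LSeries (fun m ↦ (UpperHalfPlane.qExpansion 1 ⇑g).coeff m) s :=
    fun s hs ↦ hLeq s (by push_cast; linarith)
  refine ⟨L, hL, hagree, ?_⟩
  by_contra h1
  haveI : Finite (D.A.Points ℚ) := hK L hL hagree h1
  exact not_finite (D.A.Points ℚ)

/-! ## §3 Composition (kernel-checked; no sorry below this line) -/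

/-- **The line closes the crux modulo its four stubs**: the shadow point in ideal form (V∘C1) supplies
`M, g, I` with all side conditions and `D` with `A_g(ℚ)` infinite; the congruence glue turns `I` into the
crux's typed `R, φ`; Kato (K) specialised at `(N_W·M, g, D)` feeds the analytic glue, which returns the
entire continuation `Λ` with `Λ 1 = 0`; the conclusion is the route decl `PhantomShadow` BY NAME. -/
theorem PhantomShadow_of : Sig.stub_visibleShadowPointIdeal → Sig.stub_congruenceHom_of_ideal →
    Sig.stub_katoFinite → Sig.stub_centralVanishing_of_finite →
    Summit.BirchSwinnertonDyer.BirchSwinnertonDyer.Theses.ShadowIsolation.PhantomShadow := by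
  intro hV hC hK hG W _ _ p _ hp hgood hord hirr n hn hσ
  obtain ⟨M, hM, g, I, hsq, hcop, hnew, hne, hfr, hI, hcongI, D, hinf⟩ :=
    hV W p hp hgood hord hirr n hn hσ
  obtain ⟨R, φ, hR, hcong⟩ :=
    @hC (W.conductorNorm ℤ * M) hM g hnew (p ^ n) W.frobeniusTrace I hI.le hcongI
  obtain ⟨Λ, hΛ, hΛeq, hΛ1⟩ :=
    @hG (W.conductorNorm ℤ * M) hM g D
      (fun Λ hd hs h1 ↦ @hK (W.conductorNorm ℤ * M) hM g hnew D Λ hd hs h1) hinf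
  exact ⟨M, hM, g, R, φ, hR, hsq, hcop, hnew, hne, hfr, hcong, Λ, hΛ, hΛeq, hΛ1⟩

/-- **Registered target of the skeleton** — the crux BY NAME with no hypotheses: `PhantomShadow_of` applied
to the two open stubs and the two proved glues (`#print axioms` reaches `sorryAx` exactly through
`stub_visibleShadowPointIdeal` and `stub_katoFinite`). -/
theorem PhantomShadow_skeleton :
    Summit.BirchSwinnertonDyer.BirchSwinnertonDyer.Theses.ShadowIsolation.PhantomShadow :=
  PhantomShadow_of stub_visibleShadowPointIdeal stub_congruenceHom_of_ideal stub_katoFinite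
    stub_centralVanishing_of_finite

end Summit.BirchSwinnertonDyer.BirchSwinnertonDyer.Cruxes.PhantomShadow.Birth
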